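import Literature.Probability.LatticeModels.CriticalTwoPointDCPLowerHolds
import HarnessLib

/-!
# Power counting under `η`-existence: the screened axial lower bound gives `1 + η ≤ (3 - s)/2`
# (stub S3 `stub_etaBound` of line `source-cluster-screening`, crux stmt-CriticalPhenomena-15703
# `Summit.CriticalPhenomena.Ising3DConformalLimit.Theses.SubPtolemyInterlacing.SubPtolemyFloor`)

Theorem-only file (no definition, no named fact).

What is proved. `etaBound_of_screenedAxisLower`: for every `s ≥ 0`, if the *screened* axial lower
bound holds at `β_c(3)` — `c₁ n^{s} / (χ_{4n} + n Σ_{1≤k≤2n} k⟨σ₀σ_{ke₁}⟩) ≤ ⟨σ₀σ_{ne₁}⟩` for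
`n ≥ N₁`, free state (the line's proposition `ScreenedAxisLower s`, unfolded: Duminil-Copin–Panis
2025, Theorem 1.3 / eq. (1.9) at `d = 3` with the gain `n^{s}` in the numerator) — and the
critical exponent `η = η(3)` exists in the logarithmic sense (`HasIsingExponentEta 3 η`:
`log ⟨σ₀σ_x⟩_{β_c} / log ‖x‖ → -(1+η)`), then `1 + η ≤ (3 - s)/2`, i.e. `η ≤ (1 - s)/2`. For `s = 0`
this is Theorem 1.5 of the source as printed ("Let `d = 3`. If the critical exponent `η` exists,
it satisfies `η ≤ 1/2`. *Proof.* The proof follows by plugging the estimate provided by the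
existence of `η` in (1.9)"), whose tree rendering `dcp_isingEta_le_half_of_axis_lower`
(`CriticalEtaUpperDCPProofs.lean`) is the template of this file; the power counting is
`⟨σ₀σ_{ne₁}⟩ · n^{2-η+o(1)} ≳ n^{s}`, i.e. `-(1+η) + (2-η) ≥ s`.

How (the source's `o(1)` made explicit). Write `G = ⟨σ₀σ_x⟩_{β_c}` for the free two-point
function on `ℤ³`; the tree's `criticalTwoPoint 3` (plus state) agrees with it
(`twoPointPlus_criticalBeta_eq_twoPointFree_holds`), so `log G(x)/log ‖x‖ → -(1+η)`; `G ≥ 0`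
(Griffiths) and `G(0) = 1`. Suppose `(3 - s)/2 < 1 + η`, i.e. `(1 - s)/2 < η`. Since also
`(1 - s)/2 ≤ 1/2 < 1` (`s ≥ 0`), there is `b` with `(1 - s)/2 < b < min(η, 1)`; thus
`1 - 2b - s < 0`. (1) The ansatz with `ε = η - b > 0` gives `K > 0` with `G(x) ≤ K‖x‖^{-(1+b)}`
for all `x ≠ 0` (`HasSpatialDecayExponent.exists_le_mul_rpow`). (2) Hence the denominator of (1.9)
is `≤ A n^{2-b}` for `n ≥ 1`, `A = 1 + 216K·4^{1-b} + K·2^{1-b}(1 + 1/(1-b))`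
(`screenedDenominator_le`, the template's `dcp_denominator_le` freed from its window
`1/2 < b ≤ 3/4`): the shell count `Σ_{x∈Λ_{4n}∖0} ‖x‖^{-(1+b)} ≤ 54 Σ_{m<4n} (m+1)^{1-b} ≤ 54·(4n)^{2-b}`
(`sum_box_erase_norm_rpow_le`, `b ≤ 1`) and the axis count
`Σ_{1≤k≤2n} k·k^{-(1+b)} = Σ k^{-b} ≤ (2n)^{1-b}(1 + 1/(1-b))` (`sum_Icc_rpow_sub_one_le_of_lt_one`:
for `0 ≤ b < 1` the template's `Σ_{k≤N} k^{p-1} ≤ N^p/p`, `p = 1 - b`; for `b < 0` termwise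
`k^{-b} ≤ N^{-b}`). (3) (1.9) with the gain and (1) at `x = ne₁`, for `n ≥ max(N₁, 1)`:
`c₁ n^{s} ≤ K n^{-(1+b)} · A n^{2-b} = K A n^{1-2b-s} · n^{s}`, while `K A n^{1-2b-s} → 0 < c₁`
(`tendsto_rpow_neg_atTop`) — a contradiction at `n` large.

## References

* H. Duminil-Copin, R. Panis, *New lower bounds for the (near) critical Ising and φ⁴ models'
  two-point functions*, CMP 406 (2025), arXiv:2404.05700, Theorem 1.5 and its proof (p. 6),
  Theorem 1.3, eq. (1.9) (p. 5) [DuminilCopinPanis2025LowerBounds].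
-/

noncomputable section

open Finset Filter
open _root_.Topology

namespace Summit.CriticalPhenomena.Ising3DConformalLimit.SubPtolemyFloorScreening

open Literature.Probability.LatticeModels
open scoped Classical

/-! ### The axis count for a general decay exponent `1 + b < 2` -/

/-- `Σ_{k=1}^{N} k^{(1-b)-1} (= Σ_{k=1}^{N} k^{-b}) ≤ N^{1-b} (1 + 1/(1-b))` for every `b < 1`: for
`0 ≤ b < 1` this is `Σ_{k≤N} k^{p-1} ≤ N^p/p` with `p = 1 - b ∈ (0,1]` (`sum_Icc_rpow_sub_one_le`,
Bernoulli), for `b < 0` each of the `N` terms is at most `N^{-b}`. The counting behind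
"`n^{d-2} Σ_{k ≤ 2n} k⟨τ₀τ_{ke₁}⟩_{β_c} = n^{2-η+o(1)}`" in the proof of Duminil-Copin–Panis 2025,
Thm. 1.5, for an arbitrary decay exponent `1 + b < 2`. Elementary. [folklore] -/
theorem sum_Icc_rpow_sub_one_le_of_lt_one {b : ℝ} (hb : b < 1) (N : ℕ) :
    ∑ k ∈ Finset.Icc 1 N, (k : ℝ) ^ ((1 - b) - 1) ≤ (N : ℝ) ^ (1 - b) * (1 + 1 / (1 - b)) := by
  have hN0 : (0 : ℝ) ≤ N := Nat.cast_nonneg N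
  have hp : 0 < 1 - b := by linarith
  have hpow : 0 ≤ (N : ℝ) ^ (1 - b) := Real.rpow_nonneg hN0 _
  have hinv : 0 < 1 / (1 - b) := by positivity
  rcases le_or_gt 0 b with hb0 | hb0
  · -- `0 ≤ b < 1`: `p = 1 - b ∈ (0, 1]`
    calc ∑ k ∈ Finset.Icc 1 N, (k : ℝ) ^ ((1 - b) - 1) ≤ (N : ℝ) ^ (1 - b) / (1 - b) :=
          sum_Icc_rpow_sub_one_le hp (by linarith) N
      _ = (N : ℝ) ^ (1 - b) * (1 / (1 - b)) := by ring
      _ ≤ (N : ℝ) ^ (1 - b) * (1 + 1 / (1 - b)) :=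
          mul_le_mul_of_nonneg_left (by linarith) hpow
  · -- `b < 0`: each term is at most `N^{-b}`
    have hterm : ∀ k ∈ Finset.Icc 1 N, (k : ℝ) ^ ((1 - b) - 1) ≤ (N : ℝ) ^ ((1 - b) - 1) := by
      intro k hk
      have hkN : (k : ℝ) ≤ N := by exact_mod_cast (Finset.mem_Icc.1 hk).2
      exact Real.rpow_le_rpow (Nat.cast_nonneg k) hkN (by linarith)
    have hsplit : (N : ℝ) ^ (1 - b) = (N : ℝ) * (N : ℝ) ^ ((1 - b) - 1) := by
      have h := Real.rpow_add' hN0 (y := 1) (z := (1 - b) - 1)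
        (ne_of_gt (by linarith : (0 : ℝ) < 1 + ((1 - b) - 1)))
      rw [Real.rpow_one, show (1 : ℝ) + ((1 - b) - 1) = 1 - b by ring] at h
      exact h
    calc ∑ k ∈ Finset.Icc 1 N, (k : ℝ) ^ ((1 - b) - 1)
        ≤ ∑ _k ∈ Finset.Icc 1 N, (N : ℝ) ^ ((1 - b) - 1) := Finset.sum_le_sum hterm
      _ = (N : ℝ) * (N : ℝ) ^ ((1 - b) - 1) := by
          rw [Finset.sum_const, Nat.card_Icc, Nat.add_sub_cancel, nsmul_eq_mul]
      _ = (N : ℝ) ^ (1 - b) := hsplit.symm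
      _ ≤ (N : ℝ) ^ (1 - b) * (1 + 1 / (1 - b)) := le_mul_of_one_le_right hpow (by linarith)

/-! ### The denominator of (1.9) under a power upper bound, general exponent -/

/-- **The "plugging in" of the proof of Theorem 1.5, denominator side, for a general exponent.**
If `F : ℤ³ → ℝ` has `F(0) = 1` and `F(x) ≤ K‖x‖^{-(1+b)}` for all `x ≠ 0`, with `K > 0` and
`b < 1`, then for `n ≥ 1`
`Σ_{x ∈ Λ_{4n}} F(x) + n Σ_{k=1}^{2n} k F(ke_i) ≤ (1 + 216K·4^{1-b} + K·2^{1-b}(1 + 1/(1-b))) n^{2-b}`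
(`χ_{4n} ≤ 1 + 216K·4^{1-b} n^{2-b}` by the shell estimate `sum_box_erase_norm_rpow_le`,
`Σ_{k≤2n} k F(ke_i) ≤ K·2^{1-b}(1 + 1/(1-b)) n^{1-b}` by `sum_Icc_rpow_sub_one_le_of_lt_one`). The
tree's `dcp_denominator_le` is the window `1/2 < b ≤ 3/4` with numerical constants; this is
"`χ_{4n}(β_c) + n Σ_{k ≤ 2n} k⟨τ₀τ_{ke₁}⟩_{β_c} = n^{2-η+o(1)}`" of Duminil-Copin–Panis 2025, proof
of Thm. 1.5, made quantitative for every decay exponent `1 + b < 2`. [cite: DuminilCopinPanis2025LowerBounds, proof of Theorem 1.5] -/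
theorem screenedDenominator_le {F : Site 3 → ℝ} {K b : ℝ} (hK : 0 < K) (hb : b < 1)
    (hF0 : F 0 = 1) (hFle : ∀ x, x ≠ 0 → F x ≤ K * ‖x‖ ^ (-(1 + b))) (i : Fin 3) {n : ℕ}
    (hn : 1 ≤ n) :
    (∑ x ∈ box 3 (4 * n), F x) +
        (n : ℝ) * ∑ k ∈ Finset.Icc 1 (2 * n), (k : ℝ) * F (Pi.single i (k : ℤ)) ≤
      (1 + 216 * K * 4 ^ (1 - b) + K * 2 ^ (1 - b) * (1 + 1 / (1 - b))) * (n : ℝ) ^ (2 - b) := by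
  have ht : (1 : ℝ) ≤ n := by exact_mod_cast hn
  have htpos : (0 : ℝ) < n := by linarith
  have hsplit : (n : ℝ) ^ (2 - b) = n * (n : ℝ) ^ (1 - b) := by
    rw [show (2 : ℝ) - b = 1 + (1 - b) by ring, Real.rpow_add htpos, Real.rpow_one]
  -- (1) the box sum `χ_{4n}`
  have h1 : ∑ x ∈ box 3 (4 * n), F x ≤ 1 + 216 * K * 4 ^ (1 - b) * (n : ℝ) ^ (2 - b) := by
    rw [← Finset.add_sum_erase _ _ (zero_mem_box 3 (4 * n)), hF0]
    have hA : ∑ x ∈ (box 3 (4 * n)).erase 0, F x ≤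
        K * ∑ x ∈ (box 3 (4 * n)).erase 0, ‖x‖ ^ (-(1 + b)) := by
      rw [Finset.mul_sum]
      exact Finset.sum_le_sum fun x hx => hFle x (Finset.ne_of_mem_erase hx)
    have hB := sum_box_erase_norm_rpow_le (1 + b) (4 * n)
    have hC : ∑ m ∈ Finset.range (4 * n), ((m : ℝ) + 1) ^ (2 - (1 + b)) ≤
        (4 * n : ℕ) * ((4 * n : ℕ) : ℝ) ^ (1 - b) := by
      have hle : ∀ m ∈ Finset.range (4 * n),
          ((m : ℝ) + 1) ^ (2 - (1 + b)) ≤ ((4 * n : ℕ) : ℝ) ^ (1 - b) := by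
        intro m hm
        rw [show (2 : ℝ) - (1 + b) = 1 - b by ring]
        have hm' : m + 1 ≤ 4 * n := Finset.mem_range.1 hm
        have hm'' : (m : ℝ) + 1 ≤ ((4 * n : ℕ) : ℝ) := by exact_mod_cast hm'
        exact Real.rpow_le_rpow (by positivity) hm'' (by linarith)
      calc ∑ m ∈ Finset.range (4 * n), ((m : ℝ) + 1) ^ (2 - (1 + b))
          ≤ ∑ _m ∈ Finset.range (4 * n), ((4 * n : ℕ) : ℝ) ^ (1 - b) := Finset.sum_le_sum hle
        _ = (4 * n : ℕ) * ((4 * n : ℕ) : ℝ) ^ (1 - b) := by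
            rw [Finset.sum_const, Finset.card_range, nsmul_eq_mul]
    have hD : ((4 * n : ℕ) : ℝ) * ((4 * n : ℕ) : ℝ) ^ (1 - b) =
        4 * (4 : ℝ) ^ (1 - b) * (n : ℝ) ^ (2 - b) := by
      push_cast
      rw [Real.mul_rpow (by norm_num) htpos.le, hsplit]
      ring
    have hE : ∑ x ∈ (box 3 (4 * n)).erase 0, F x ≤
        216 * K * 4 ^ (1 - b) * (n : ℝ) ^ (2 - b) := by
      calc ∑ x ∈ (box 3 (4 * n)).erase 0, F x
          ≤ K * ∑ x ∈ (box 3 (4 * n)).erase 0, ‖x‖ ^ (-(1 + b)) := hA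
        _ ≤ K * (54 * ∑ m ∈ Finset.range (4 * n), ((m : ℝ) + 1) ^ (2 - (1 + b))) :=
            mul_le_mul_of_nonneg_left hB hK.le
        _ ≤ K * (54 * ((4 * n : ℕ) * ((4 * n : ℕ) : ℝ) ^ (1 - b))) := by gcongr
        _ = K * (54 * (4 * (4 : ℝ) ^ (1 - b) * (n : ℝ) ^ (2 - b))) := by rw [hD]
        _ = 216 * K * 4 ^ (1 - b) * (n : ℝ) ^ (2 - b) := by ring
    linarith
  -- (2) the axis sum
  have h2 : ∑ k ∈ Finset.Icc 1 (2 * n), (k : ℝ) * F (Pi.single i (k : ℤ)) ≤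
      K * 2 ^ (1 - b) * (1 + 1 / (1 - b)) * (n : ℝ) ^ (1 - b) := by
    have hterm : ∀ k ∈ Finset.Icc 1 (2 * n),
        (k : ℝ) * F (Pi.single i (k : ℤ)) ≤ K * (k : ℝ) ^ ((1 - b) - 1) := by
      intro k hk
      have hk1 : 1 ≤ k := (Finset.mem_Icc.1 hk).1
      have hkpos : (0 : ℝ) < k := by exact_mod_cast hk1
      have hne : (Pi.single i (k : ℤ) : Site 3) ≠ 0 := by
        intro h
        have h0 := congr_fun h i
        simp at h0
        omega
      have hnorm : ‖(Pi.single i (k : ℤ) : Site 3)‖ = k := by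
        rw [Pi.norm_single, Int.norm_natCast]
      have hFk := hFle _ hne
      rw [hnorm] at hFk
      calc (k : ℝ) * F (Pi.single i (k : ℤ)) ≤ (k : ℝ) * (K * (k : ℝ) ^ (-(1 + b))) :=
            mul_le_mul_of_nonneg_left hFk hkpos.le
        _ = K * ((k : ℝ) ^ (1 : ℝ) * (k : ℝ) ^ (-(1 + b))) := by
            rw [Real.rpow_one]
            ring
        _ = K * (k : ℝ) ^ ((1 - b) - 1) := by
            rw [← Real.rpow_add hkpos, show (1 : ℝ) + -(1 + b) = (1 - b) - 1 by ring]
    have hx : ((2 * n : ℕ) : ℝ) ^ (1 - b) = 2 ^ (1 - b) * (n : ℝ) ^ (1 - b) := by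
      push_cast
      exact Real.mul_rpow (by norm_num) htpos.le
    calc ∑ k ∈ Finset.Icc 1 (2 * n), (k : ℝ) * F (Pi.single i (k : ℤ))
        ≤ ∑ k ∈ Finset.Icc 1 (2 * n), K * (k : ℝ) ^ ((1 - b) - 1) := Finset.sum_le_sum hterm
      _ = K * ∑ k ∈ Finset.Icc 1 (2 * n), (k : ℝ) ^ ((1 - b) - 1) := by rw [Finset.mul_sum]
      _ ≤ K * (((2 * n : ℕ) : ℝ) ^ (1 - b) * (1 + 1 / (1 - b))) :=
          mul_le_mul_of_nonneg_left (sum_Icc_rpow_sub_one_le_of_lt_one hb _) hK.le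
      _ = K * 2 ^ (1 - b) * (1 + 1 / (1 - b)) * (n : ℝ) ^ (1 - b) := by
          rw [hx]
          ring
  -- (3) combine
  have hone : 1 ≤ (n : ℝ) ^ (2 - b) := Real.one_le_rpow ht (by linarith)
  calc (∑ x ∈ box 3 (4 * n), F x) +
        (n : ℝ) * ∑ k ∈ Finset.Icc 1 (2 * n), (k : ℝ) * F (Pi.single i (k : ℤ))
      ≤ (1 + 216 * K * 4 ^ (1 - b) * (n : ℝ) ^ (2 - b)) +
          (n : ℝ) * (K * 2 ^ (1 - b) * (1 + 1 / (1 - b)) * (n : ℝ) ^ (1 - b)) :=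
        add_le_add h1 (mul_le_mul_of_nonneg_left h2 htpos.le)
    _ = 1 + (216 * K * 4 ^ (1 - b) + K * 2 ^ (1 - b) * (1 + 1 / (1 - b))) * (n : ℝ) ^ (2 - b) := by
        rw [hsplit]
        ring
    _ ≤ (1 + 216 * K * 4 ^ (1 - b) + K * 2 ^ (1 - b) * (1 + 1 / (1 - b))) * (n : ℝ) ^ (2 - b) := by
        linarith [hone]

/-! ### Theorem 1.5 with the gain `n^{s}` -/

/-- **S3.** For every `s ≥ 0`: if the screened axial lower bound
`c₁ n^{s} / (χ_{4n} + n Σ_{1≤k≤2n} k⟨σ₀σ_{ke₁}⟩) ≤ ⟨σ₀σ_{ne₁}⟩` holds at `β_c(3)` for `n ≥ N₁` (the line's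
`ScreenedAxisLower s`, unfolded) and the critical exponent `η(3)` exists in the logarithmic sense
(`HasIsingExponentEta 3 η`), then `1 + η ≤ (3 - s)/2`. [cite: DuminilCopinPanis2025LowerBounds, Theorem 1.5 and its proof (arXiv p. 6)] -/
theorem etaBound_of_screenedAxisLower (s : ℝ) (hs : 0 ≤ s)
    (h13 : ∃ c₁ : ℝ, 0 < c₁ ∧ ∃ N₁ : ℕ, 0 < N₁ ∧ ∀ n : ℕ, N₁ ≤ n →
      c₁ * (n : ℝ) ^ s / ((∑ x ∈ box 3 (4 * n), twoPointFree 3 (criticalBeta 3) x) +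
            (n : ℝ) ^ (3 - 2) *
              ∑ k ∈ Finset.Icc 1 (2 * n),
                (k : ℝ) * twoPointFree 3 (criticalBeta 3) (Pi.single (⟨0, by omega⟩ : Fin 3) (k : ℤ)))
        ≤ twoPointFree 3 (criticalBeta 3) (Pi.single (⟨0, by omega⟩ : Fin 3) (n : ℤ)))
    (η : ℝ) (hη : HasIsingExponentEta 3 η) : 1 + η ≤ (3 - s) / 2 := by
  by_contra hgt
  push Not at hgt
  -- the source's two-point function is the free state; the tree's `criticalTwoPoint` is the plus
  -- state; they agree at `β_c` on `ℤ³`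
  have hGeq : ∀ x, criticalTwoPoint 3 x = twoPointFree 3 (criticalBeta 3) x :=
    twoPointPlus_criticalBeta_eq_twoPointFree_holds (d := 3) (by norm_num)
  -- the ansatz, exponent `1 + η`, for the free two-point function
  have hexp : HasSpatialDecayExponent (twoPointFree 3 (criticalBeta 3)) (1 + η) := by
    have h : HasSpatialDecayExponent (criticalTwoPoint 3) (((3 : ℕ) : ℝ) - 2 + η) := hη
    rw [show ((3 : ℕ) : ℝ) - 2 + η = 1 + η by push_cast; ring] at h
    have hfun : (fun x : Site 3 => Real.log (criticalTwoPoint 3 x) / Real.log ‖x‖) =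
        fun x => Real.log (twoPointFree 3 (criticalBeta 3) x) / Real.log ‖x‖ := by
      funext x
      rw [hGeq]
    unfold HasSpatialDecayExponent at h ⊢
    rwa [hfun] at h
  -- `G(0) = 1`, `G ≥ 0` (Griffiths)
  have hF0 : twoPointFree 3 (criticalBeta 3) 0 = 1 := twoPointFree_zero 3 _
  have hFnn : ∀ x, 0 ≤ twoPointFree 3 (criticalBeta 3) x :=
    twoPointFree_nonneg' (criticalBeta_nonneg 3)
  -- the window `((1 - s)/2, min η 1)` of the auxiliary exponent `b` is nonempty: `(1 - s)/2 < η`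
  -- is the negated conclusion, and `(1 - s)/2 ≤ 1/2 < 1` as `s ≥ 0`
  have hwin : (1 - s) / 2 < min η 1 := lt_min (by linarith) (by linarith)
  obtain ⟨b, hblo, hbη, hb1⟩ : ∃ b : ℝ, (1 - s) / 2 < b ∧ b < η ∧ b < 1 :=
    ⟨((1 - s) / 2 + min η 1) / 2, by linarith, by linarith [min_le_left η 1],
      by linarith [min_le_right η 1]⟩
  have hbs : 1 - 2 * b - s < 0 := by linarith
  -- "the estimate provided by the existence of η": `G(x) ≤ K‖x‖^{-(1+b)}`, all `x ≠ 0`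
  obtain ⟨K, hK, hFle⟩ : ∃ K : ℝ, 0 < K ∧ ∀ x : Site 3, x ≠ 0 →
      twoPointFree 3 (criticalBeta 3) x ≤ K * ‖x‖ ^ (-(1 + b)) := by
    obtain ⟨K, hK, h⟩ := hexp.exists_le_mul_rpow (ε := η - b) (by linarith)
    refine ⟨K, hK, fun x hx => ?_⟩
    have := h x hx
    rwa [show -(1 + η) + (η - b) = -(1 + b) by ring] at this
  -- the denominator of (1.9) is `≤ A n^{2-b}` for `n ≥ 1`
  obtain ⟨A, hDleA⟩ : ∃ A : ℝ, ∀ m : ℕ, 1 ≤ m →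
      (∑ x ∈ box 3 (4 * m), twoPointFree 3 (criticalBeta 3) x) +
          (m : ℝ) * ∑ k ∈ Finset.Icc 1 (2 * m),
            (k : ℝ) * twoPointFree 3 (criticalBeta 3) (Pi.single (⟨0, by norm_num⟩ : Fin 3) (k : ℤ)) ≤
        A * (m : ℝ) ^ (2 - b) :=
    ⟨_, fun m hm => screenedDenominator_le hK hb1 hF0 hFle (⟨0, by norm_num⟩ : Fin 3) hm⟩
  -- the screened (1.9)
  obtain ⟨c₁, hc₁, N₁, -, hmain⟩ := h13
  -- `K A n^{1-2b-s} → 0`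
  have hlim : Tendsto (fun n : ℕ => K * A * (n : ℝ) ^ (1 - 2 * b - s)) atTop (𝓝 0) := by
    have h1 : Tendsto (fun t : ℝ => t ^ (1 - 2 * b - s)) atTop (𝓝 0) := by
      have := tendsto_rpow_neg_atTop (y := -(1 - 2 * b - s)) (by linarith)
      simpa only [neg_neg] using this
    have h2 : Tendsto (fun n : ℕ => (n : ℝ) ^ (1 - 2 * b - s)) atTop (𝓝 0) :=
      h1.comp tendsto_natCast_atTop_atTop
    simpa only [mul_zero] using h2.const_mul (K * A)
  obtain ⟨n, hnlt, hnge⟩ :=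
    ((hlim.eventually (gt_mem_nhds hc₁)).and (eventually_ge_atTop (max N₁ 1))).exists
  have hnN : N₁ ≤ n := le_of_max_le_left hnge
  have hn1 : 1 ≤ n := le_of_max_le_right hnge
  have htpos : (0 : ℝ) < n := by exact_mod_cast hn1
  -- (1.9) with the gain, at this `n`
  have h19 := hmain n hnN
  rw [show (3 - 2 : ℕ) = 1 from rfl, pow_one] at h19
  -- the ansatz at `x = n e₁`
  have hne : (Pi.single (⟨0, by norm_num⟩ : Fin 3) ((n : ℕ) : ℤ) : Site 3) ≠ 0 := by
    intro h
    have h0 := congr_fun h ⟨0, by norm_num⟩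
    simp at h0
    omega
  have hup : twoPointFree 3 (criticalBeta 3) (Pi.single (⟨0, by norm_num⟩ : Fin 3) ((n : ℕ) : ℤ)) ≤
      K * (n : ℝ) ^ (-(1 + b)) := by
    have := hFle _ hne
    rwa [Pi.norm_single, Int.norm_natCast] at this
  have hDpos := dcp_denominator_pos hF0 hFnn (⟨0, by norm_num⟩ : Fin 3) n
  have hdiv := (div_le_iff₀ hDpos).1 (h19.trans hup)
  have hns : 0 < (n : ℝ) ^ s := Real.rpow_pos_of_pos htpos s
  have hchain : c₁ * (n : ℝ) ^ s ≤ K * A * (n : ℝ) ^ (1 - 2 * b - s) * (n : ℝ) ^ s := by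
    calc c₁ * (n : ℝ) ^ s ≤ K * (n : ℝ) ^ (-(1 + b)) * _ := hdiv
      _ ≤ K * (n : ℝ) ^ (-(1 + b)) * (A * (n : ℝ) ^ (2 - b)) :=
          mul_le_mul_of_nonneg_left (hDleA n hn1) (by positivity)
      _ = K * A * ((n : ℝ) ^ (-(1 + b)) * (n : ℝ) ^ (2 - b)) := by ring
      _ = K * A * (n : ℝ) ^ (1 - 2 * b - s + s) := by
          rw [← Real.rpow_add htpos, show -(1 + b) + (2 - b) = 1 - 2 * b - s + s by ring]
      _ = K * A * (n : ℝ) ^ (1 - 2 * b - s) * (n : ℝ) ^ s := by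
          rw [Real.rpow_add htpos]
          ring
  have hlt : K * A * (n : ℝ) ^ (1 - 2 * b - s) * (n : ℝ) ^ s < c₁ * (n : ℝ) ^ s :=
    mul_lt_mul_of_pos_right hnlt hns
  linarith

end Summit.CriticalPhenomena.Ising3DConformalLimit.SubPtolemyFloorScreening

end
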